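import Mathlib
import Literature.Computability.AlgebraicComplexity.StandardFamilies

/-!
# Crux `WordLengthQP` (stmt-ValiantsHypothesis-6623), line `Sketch` (eps-order-ladder) —
rung `q = 1` of the ε-order ladder is UNIVERSAL (length-free): every polynomial is computed at
ε-order one

The ε-order ladder of the line (`EpsOrderLadder` ⟺ the crux, tree theorems `stub_transfer`,
`ladder_iff_wordLengthQP`) was split by seat c2 into its exact rung `q = 0` — a THEOREM
(`rung0_nonuniversal`: for `n ≥ 10`, `per_n` is not the `(0,0)` entry of any product of width-2
matrices with S-affine entries over `ℂ[x̄]`, of ANY length; Allender–Wang non-universality) — and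
the open stub `stub_ladder_pos` (rungs `q ≥ 1` at quasi-polynomial ε-order and length).

This file settles the natural next question: is the rung `q = 1` also non-universal, so that an
Allender–Wang type (length-free) substitution/factorisation argument could climb one more rung?
NO.  **Order-one universality** (`rungOne_universal`): for every `f ∈ ℂ[x̄]` (any set of variables)
there is a product of width-2 matrices over `ℂ[ε][x̄]` with S-affine entries whose `(0,0)` entry is
`ε · f + ε² · G`.  Hence the length-free strengthening of the rung `q = 1` is FALSE for `per_n` at
every `n` (`rungOne_perPoly`, `rungOne_not_lengthFree`): above the exact rung, every rung of the
ladder is irreducibly LENGTH-SENSITIVE (a genuine lower-bound problem), and the AW engine of the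
line is exhausted exactly at `q = 0`.

Proof (an `sl₂`-ladder inside the order-one programs).  Write `M♯` for coefficient extension
`ℂ[x̄] → ℂ[ε][x̄]` and say a matrix `M` over `ℂ[x̄]` is ORDER-ONE COMPUTED if some S-affine product
equals `1 + ε • M♯ + ε² • R`.  (i) A single letter `1 + ε • N♯` computes any S-affine `N`;
(ii) concatenation ADDS (`(1 + εM♯ + …)(1 + εM'♯ + …) = 1 + ε(M + M')♯ + …`); (iii) sandwiching by
an S-affine letter `U` and its S-affine inverse `V` CONJUGATES (`M ↦ U M V`).  With
`E = E₀₁`, `H' = E₁₁ - E₀₀`, the transvections `T₁₀(±x_v)` and `T₀₁(±1)` give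
`Ad_{T₁₀(x_v)}(c g E) + Ad_{T₁₀(-x_v)}(-c g E) = 2c · x_v g · H'` and
`Ad_{T₀₁(1)}(c h H') + Ad_{T₀₁(-1)}(-c h H') = 4c · h · E`,
so `g E ↦ x_v g E` is order-one computable for all scalar multiples at once; by
`MvPolynomial.induction_on` every `f • E` is, and a final constant letter `J = E₀₁ + E₁₀` moves
`f` to the `(0,0)` entry.  (The programs have length `≤ 5 · 4^{deg} · #monomials + 1`; only
existence is recorded here.)

Nearest literature: K. Bringmann, C. Ikenmeyer, J. Zuiddam, J. ACM 65 (2018) §3 (universality of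
border width 2 with approximation order growing with the formula; the tree's `ladderPos_universal`
has order `≤ 3·25ⁿ·n!` for `per_n`); E. Allender, F. Wang, Comput. Complexity 25 (2016) (rung 0).
We know no reference for order ONE; the statement and proof here are this line's own.
-/

-- `Summit.ValiantsHypothesis.ValiantsHypothesis.…` is the tree's mandated single-conjunct layout
-- (Sub = Summit), so the duplicated namespace component is intended.
set_option linter.dupNamespace false

noncomputable section

open MvPolynomial

namespace Summit.ValiantsHypothesis.ValiantsHypothesis.Cruxes.WordLengthQP.EpsOrderLadder

/-- `O1[σ | M]` (local notation): the width-2 matrix `M` over `ℂ[x̄]` is ORDER-ONE COMPUTED —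
some product of width-2 matrices over `ℂ[ε][x̄]` with S-affine entries equals
`1 + ε • M♯ + ε² • R`. -/
local notation3 (prettyPrint := false) "O1[" σ " | " M "]" =>
  ∃ ms : List (Matrix (Fin 2) (Fin 2) (MvPolynomial σ (Polynomial ℂ))),
    (∀ m ∈ ms, ∀ i j : Fin 2, (∃ b : Polynomial ℂ, m i j = MvPolynomial.C b) ∨
      (∃ (a b : Polynomial ℂ) (v : σ),
        m i j = MvPolynomial.C a * MvPolynomial.X v + MvPolynomial.C b)) ∧
    ∃ R : Matrix (Fin 2) (Fin 2) (MvPolynomial σ (Polynomial ℂ)),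
      ms.prod = 1 + (MvPolynomial.C Polynomial.X : MvPolynomial σ (Polynomial ℂ)) •
          (M : Matrix (Fin 2) (Fin 2) (MvPolynomial σ ℂ)).map
            (MvPolynomial.map (σ := σ) Polynomial.C) +
        (MvPolynomial.C (Polynomial.X ^ 2) : MvPolynomial σ (Polynomial ℂ)) • R

/-! ### The three closure properties of order-one computation -/

/-- (i) One letter `1 + ε • N♯` computes any S-affine `N` at order one. [folklore] -/
theorem rungOneU_letter {σ : Type} (N : Matrix (Fin 2) (Fin 2) (MvPolynomial σ ℂ))
    (hN : ∀ i j : Fin 2, (∃ b : ℂ, N i j = MvPolynomial.C b) ∨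
      (∃ (a b : ℂ) (v : σ), N i j = MvPolynomial.C a * MvPolynomial.X v + MvPolynomial.C b)) :
    O1[σ | N] := by
  refine ⟨[1 + (MvPolynomial.C Polynomial.X : MvPolynomial σ (Polynomial ℂ)) •
    N.map (MvPolynomial.map (σ := σ) Polynomial.C)], ?_, 0, by simp⟩
  intro m hm i j
  rw [List.mem_singleton] at hm
  subst hm
  rcases hN i j with ⟨b, hb⟩ | ⟨a, b, v, hab⟩
  · left
    by_cases hij : i = j
    · subst hij
      refine ⟨1 + Polynomial.X * Polynomial.C b, ?_⟩
      simp [Matrix.add_apply, Matrix.smul_apply, Matrix.map_apply, hb, MvPolynomial.map_C]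
      ring
    · refine ⟨Polynomial.X * Polynomial.C b, ?_⟩
      simp [Matrix.add_apply, Matrix.smul_apply, Matrix.map_apply, hb, MvPolynomial.map_C,
        Matrix.one_apply_ne hij]
      ring
  · right
    by_cases hij : i = j
    · subst hij
      refine ⟨Polynomial.X * Polynomial.C a, 1 + Polynomial.X * Polynomial.C b, v, ?_⟩
      simp [Matrix.add_apply, Matrix.smul_apply, Matrix.map_apply, hab, MvPolynomial.map_C,
        MvPolynomial.map_X]
      ring
    · refine ⟨Polynomial.X * Polynomial.C a, Polynomial.X * Polynomial.C b, v, ?_⟩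
      simp [Matrix.add_apply, Matrix.smul_apply, Matrix.map_apply, hab, MvPolynomial.map_C,
        MvPolynomial.map_X, Matrix.one_apply_ne hij]
      ring

/-- (ii) Concatenation adds: order-one computed matrices form an additive semigroup. [folklore] -/
theorem rungOneU_add {σ : Type} {M M' : Matrix (Fin 2) (Fin 2) (MvPolynomial σ ℂ)}
    (hM : O1[σ | M]) (hM' : O1[σ | M']) : O1[σ | M + M'] := by
  obtain ⟨ms, hS, R, hR⟩ := hM
  obtain ⟨ms', hS', R', hR'⟩ := hM'
  refine ⟨ms ++ ms', fun m hm => ?_, ?_⟩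
  · rcases List.mem_append.1 hm with h | h
    · exact hS m h
    · exact hS' m h
  · set φ : MvPolynomial σ ℂ →+* MvPolynomial σ (Polynomial ℂ) :=
      MvPolynomial.map (σ := σ) Polynomial.C with hφ
    set e : MvPolynomial σ (Polynomial ℂ) := MvPolynomial.C Polynomial.X with he
    have he2 : (MvPolynomial.C (Polynomial.X ^ 2) : MvPolynomial σ (Polynomial ℂ)) = e * e := by
      rw [he, ← map_mul, pow_two]
    refine ⟨R + R' + M.map φ * M'.map φ + e • (M.map φ * R') + e • (R * M'.map φ) +
      (e * e) • (R * R'), ?_⟩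
    have hmapadd : (M + M').map φ = M.map φ + M'.map φ := Matrix.map_add _ (map_add φ) M M'
    rw [List.prod_append, hR, hR', he2, hmapadd]
    simp only [Matrix.add_mul, Matrix.mul_add, Matrix.one_mul, Matrix.mul_one, Matrix.smul_mul,
      Matrix.mul_smul, smul_add, smul_smul, mul_assoc]
    abel

/-- S-affinity over `ℂ` is preserved by coefficient extension to `ℂ[ε]`. [folklore] -/
theorem rungOneU_map_sAffine {σ : Type} (U : Matrix (Fin 2) (Fin 2) (MvPolynomial σ ℂ))
    (hU : ∀ i j : Fin 2, (∃ b : ℂ, U i j = MvPolynomial.C b) ∨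
      (∃ (a b : ℂ) (v : σ), U i j = MvPolynomial.C a * MvPolynomial.X v + MvPolynomial.C b))
    (i j : Fin 2) :
    (∃ b : Polynomial ℂ, U.map (MvPolynomial.map (σ := σ) Polynomial.C) i j = MvPolynomial.C b) ∨
      (∃ (a b : Polynomial ℂ) (v : σ), U.map (MvPolynomial.map (σ := σ) Polynomial.C) i j =
        MvPolynomial.C a * MvPolynomial.X v + MvPolynomial.C b) := by
  rcases hU i j with ⟨b, hb⟩ | ⟨a, b, v, hab⟩
  · exact Or.inl ⟨Polynomial.C b, by simp [Matrix.map_apply, hb, MvPolynomial.map_C]⟩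
  · exact Or.inr ⟨Polynomial.C a, Polynomial.C b, v, by
      simp [Matrix.map_apply, hab, MvPolynomial.map_C, MvPolynomial.map_X]⟩

/-- (iii) Sandwiching by an S-affine letter `U` over `ℂ` and an S-affine `V` with `U V = 1`
conjugates: `M ↦ U M V` is order-one computed. [folklore] -/
theorem rungOneU_conj {σ : Type} {M : Matrix (Fin 2) (Fin 2) (MvPolynomial σ ℂ)}
    (U V : Matrix (Fin 2) (Fin 2) (MvPolynomial σ ℂ)) (hUV : U * V = 1)
    (hU : ∀ i j : Fin 2, (∃ b : ℂ, U i j = MvPolynomial.C b) ∨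
      (∃ (a b : ℂ) (v : σ), U i j = MvPolynomial.C a * MvPolynomial.X v + MvPolynomial.C b))
    (hV : ∀ i j : Fin 2, (∃ b : ℂ, V i j = MvPolynomial.C b) ∨
      (∃ (a b : ℂ) (v : σ), V i j = MvPolynomial.C a * MvPolynomial.X v + MvPolynomial.C b))
    (hM : O1[σ | M]) : O1[σ | U * M * V] := by
  obtain ⟨ms, hS, R, hR⟩ := hM
  set φ : MvPolynomial σ ℂ →+* MvPolynomial σ (Polynomial ℂ) :=
    MvPolynomial.map (σ := σ) Polynomial.C with hφ
  refine ⟨[U.map φ] ++ ms ++ [V.map φ], fun m hm => ?_, ?_⟩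
  · simp only [List.mem_append, List.mem_singleton] at hm
    rcases hm with (rfl | h) | rfl
    · exact rungOneU_map_sAffine U hU
    · exact hS m h
    · exact rungOneU_map_sAffine V hV
  · set e : MvPolynomial σ (Polynomial ℂ) := MvPolynomial.C Polynomial.X with he
    refine ⟨U.map φ * R * V.map φ, ?_⟩
    have hmapmul : ∀ P Q : Matrix (Fin 2) (Fin 2) (MvPolynomial σ ℂ),
        (P * Q).map φ = P.map φ * Q.map φ := fun P Q => Matrix.map_mul
    have hone : (U.map φ) * (V.map φ) = 1 := by
      rw [← hmapmul, hUV, Matrix.map_one _ (map_zero φ) (map_one φ)]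
    rw [List.prod_append, List.prod_append, List.prod_singleton, List.prod_singleton, hR,
      hmapmul, hmapmul]
    simp only [Matrix.add_mul, Matrix.mul_add, Matrix.mul_one, Matrix.smul_mul, Matrix.mul_smul,
      Matrix.mul_assoc]
    rw [hone]

/-! ### The `sl₂`-ladder: multiplying the computed polynomial by a variable -/

/-- Halving the scalar: a statement for all scalars `2c` is a statement for all scalars. [folklore] -/
theorem rungOneU_half {P : ℂ → Prop} (h : ∀ c : ℂ, P (2 * c)) : ∀ c : ℂ, P c := by
  intro c
  have := h (c / 2)
  rwa [show (2 : ℂ) * (c / 2) = c by ring] at this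

/-- Quartering the scalar. [folklore] -/
theorem rungOneU_quarter {P : ℂ → Prop} (h : ∀ c : ℂ, P (4 * c)) : ∀ c : ℂ, P c := by
  intro c
  have := h (c / 4)
  rwa [show (4 : ℂ) * (c / 4) = c by ring] at this

/-- Transport of order-one computation along an equality of matrices. [folklore] -/
theorem rungOneU_congr {σ : Type} {M M' : Matrix (Fin 2) (Fin 2) (MvPolynomial σ ℂ)}
    (hMM' : M = M') (h : O1[σ | M]) : O1[σ | M'] := hMM' ▸ h

/-- Step F (`T₁₀(±x_v)`): if all scalar multiples of `g • E₀₁` are order-one computed then so are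
all scalar multiples of `x_v g • (E₁₁ - E₀₀)`:
`Ad_{T₁₀(x_v)}(c g E) + Ad_{T₁₀(-x_v)}(-c g E) = 2c x_v g (E₁₁ - E₀₀)`. [folklore] -/
theorem rungOneU_stepF {σ : Type} (g : MvPolynomial σ ℂ) (v : σ)
    (h : ∀ c : ℂ, O1[σ | !![0, MvPolynomial.C c * g; 0, 0]]) :
    ∀ c : ℂ, O1[σ | !![-(MvPolynomial.C c * (MvPolynomial.X v * g)), 0;
      0, MvPolynomial.C c * (MvPolynomial.X v * g)]] := by
  refine rungOneU_half fun c => ?_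
  -- the two letters `T₁₀(s x_v)`
  have hT : ∀ s : ℂ, ∀ i j : Fin 2,
      (∃ b : ℂ, (!![1, 0; MvPolynomial.C s * MvPolynomial.X v, 1] :
        Matrix (Fin 2) (Fin 2) (MvPolynomial σ ℂ)) i j = MvPolynomial.C b) ∨
      (∃ (a b : ℂ) (w : σ), (!![1, 0; MvPolynomial.C s * MvPolynomial.X v, 1] :
        Matrix (Fin 2) (Fin 2) (MvPolynomial σ ℂ)) i j =
          MvPolynomial.C a * MvPolynomial.X w + MvPolynomial.C b) := by
    intro s i j
    fin_cases i <;> fin_cases j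
    · exact Or.inl ⟨1, by simp⟩
    · exact Or.inl ⟨0, by simp⟩
    · exact Or.inr ⟨s, 0, v, by simp⟩
    · exact Or.inl ⟨1, by simp⟩
  have hinv : ∀ s : ℂ, (!![1, 0; MvPolynomial.C s * MvPolynomial.X v, 1] :
      Matrix (Fin 2) (Fin 2) (MvPolynomial σ ℂ)) *
      !![1, 0; MvPolynomial.C (-s) * MvPolynomial.X v, 1] = 1 := by
    intro s
    refine Matrix.ext fun i j => ?_
    fin_cases i <;> fin_cases j <;> simp [Matrix.mul_apply, Fin.sum_univ_two]
  have h1 := rungOneU_conj (M := !![0, MvPolynomial.C c * g; 0, 0])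
    (!![1, 0; MvPolynomial.C 1 * MvPolynomial.X v, 1])
    (!![1, 0; MvPolynomial.C (-1) * MvPolynomial.X v, 1]) (hinv 1) (hT 1) (hT (-1)) (h c)
  have h2 := rungOneU_conj (M := !![0, MvPolynomial.C (-c) * g; 0, 0])
    (!![1, 0; MvPolynomial.C (-1) * MvPolynomial.X v, 1])
    (!![1, 0; MvPolynomial.C (-(-1)) * MvPolynomial.X v, 1])
    (hinv (-1)) (hT (-1)) (hT (-(-1))) (h (-c))
  refine rungOneU_congr (Matrix.ext fun i j => ?_) (rungOneU_add h1 h2)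
  fin_cases i <;> fin_cases j
  · simp [map_neg, map_one, map_mul, map_ofNat]; ring
  · simp [map_neg, map_one, map_mul, map_ofNat]
  · simp [map_neg, map_one, map_mul, map_ofNat]
  · simp [map_neg, map_one, map_mul, map_ofNat]; ring

/-- Step E (`T₀₁(±1)`): if all scalar multiples of `h • (E₁₁ - E₀₀)` are order-one computed then
so are all scalar multiples of `h • E₀₁`:
`Ad_{T₀₁(1)}(c h H') + Ad_{T₀₁(-1)}(-c h H') = 4c h E₀₁`. [folklore] -/
theorem rungOneU_stepE {σ : Type} (g : MvPolynomial σ ℂ)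
    (h : ∀ c : ℂ, O1[σ | !![-(MvPolynomial.C c * g), 0; 0, MvPolynomial.C c * g]]) :
    ∀ c : ℂ, O1[σ | !![0, MvPolynomial.C c * g; 0, 0]] := by
  refine rungOneU_quarter fun c => ?_
  -- the two constant letters `T₀₁(s)`
  have hT : ∀ s : ℂ, ∀ i j : Fin 2,
      (∃ b : ℂ, (!![1, MvPolynomial.C s; 0, 1] :
        Matrix (Fin 2) (Fin 2) (MvPolynomial σ ℂ)) i j = MvPolynomial.C b) ∨
      (∃ (a b : ℂ) (w : σ), (!![1, MvPolynomial.C s; 0, 1] :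
        Matrix (Fin 2) (Fin 2) (MvPolynomial σ ℂ)) i j =
          MvPolynomial.C a * MvPolynomial.X w + MvPolynomial.C b) := by
    intro s i j
    fin_cases i <;> fin_cases j
    · exact Or.inl ⟨1, by simp⟩
    · exact Or.inl ⟨s, by simp⟩
    · exact Or.inl ⟨0, by simp⟩
    · exact Or.inl ⟨1, by simp⟩
  have hinv : ∀ s : ℂ, (!![1, MvPolynomial.C s; 0, 1] :
      Matrix (Fin 2) (Fin 2) (MvPolynomial σ ℂ)) * !![1, MvPolynomial.C (-s); 0, 1] = 1 := by
    intro s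
    refine Matrix.ext fun i j => ?_
    fin_cases i <;> fin_cases j <;> simp [Matrix.mul_apply, Fin.sum_univ_two]
  have h1 := rungOneU_conj (M := !![-(MvPolynomial.C c * g), 0; 0, MvPolynomial.C c * g])
    (!![1, MvPolynomial.C 1; 0, 1]) (!![1, MvPolynomial.C (-1); 0, 1])
    (hinv 1) (hT 1) (hT (-1)) (h c)
  have h2 := rungOneU_conj (M := !![-(MvPolynomial.C (-c) * g), 0; 0, MvPolynomial.C (-c) * g])
    (!![1, MvPolynomial.C (-1); 0, 1]) (!![1, MvPolynomial.C (-(-1)); 0, 1])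
    (hinv (-1)) (hT (-1)) (hT (-(-1))) (h (-c))
  refine rungOneU_congr (Matrix.ext fun i j => ?_) (rungOneU_add h1 h2)
  fin_cases i <;> fin_cases j
  · simp [map_neg, map_one, map_mul, map_ofNat]
  · simp [map_neg, map_one, map_mul, map_ofNat]; ring
  · simp [map_neg, map_one, map_mul, map_ofNat]
  · simp [map_neg, map_one, map_mul, map_ofNat]

/-- **Every `f • E₀₁` is order-one computed, with all its scalar multiples** (induction on `f`:
constants are letters, sums concatenate, and `f ↦ f · x_v` is Step F followed by Step E). -/
theorem rungOneU_smul_E (σ : Type) (f : MvPolynomial σ ℂ) :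
    ∀ c : ℂ, O1[σ | !![0, MvPolynomial.C c * f; 0, 0]] := by
  induction f using MvPolynomial.induction_on with
  | C a =>
    intro c
    refine rungOneU_letter _ fun i j => ?_
    fin_cases i <;> fin_cases j
    · exact Or.inl ⟨0, by simp⟩
    · exact Or.inl ⟨c * a, by simp⟩
    · exact Or.inl ⟨0, by simp⟩
    · exact Or.inl ⟨0, by simp⟩
  | add p q hp hq =>
    intro c
    refine rungOneU_congr (Matrix.ext fun i j => ?_) (rungOneU_add (hp c) (hq c))
    fin_cases i <;> fin_cases j
    · simp
    · simp [mul_add]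
    · simp
    · simp
  | mul_X p v hp =>
    intro c
    refine rungOneU_congr ?_ (rungOneU_stepE (MvPolynomial.X v * p) (rungOneU_stepF p v hp) c)
    rw [mul_comm (MvPolynomial.X v) p]

/-! ### Order-one universality and the rung `q = 1` of the ladder -/

/-- **Order-one universality of border width-2 S-affine programs.**  For every polynomial `f`
over `ℂ` in any set of variables there is a product of width-2 matrices over `ℂ[ε][x̄]` with
S-affine entries (`C b` or `C a · X v + C b`, `a b ∈ ℂ[ε]`) whose `(0,0)` entry is
`ε · f + ε² · G`: the polynomial is computed at ε-order ONE. -/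
theorem rungOne_universal {σ : Type} (f : MvPolynomial σ ℂ) :
    ∃ ms : List (Matrix (Fin 2) (Fin 2) (MvPolynomial σ (Polynomial ℂ))),
      (∀ m ∈ ms, ∀ i j : Fin 2, (∃ b : Polynomial ℂ, m i j = MvPolynomial.C b) ∨
        (∃ (a b : Polynomial ℂ) (v : σ),
          m i j = MvPolynomial.C a * MvPolynomial.X v + MvPolynomial.C b)) ∧
      ∃ G : MvPolynomial σ (Polynomial ℂ),
        ms.prod 0 0 = MvPolynomial.C Polynomial.X * MvPolynomial.map Polynomial.C f +
          MvPolynomial.C (Polynomial.X ^ 2) * G := by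
  obtain ⟨ms, hS, R, hR⟩ := rungOneU_smul_E σ f 1
  refine ⟨ms ++ [!![0, 1; 1, 0]], fun m hm => ?_, R 0 1, ?_⟩
  · rcases List.mem_append.1 hm with h | h
    · exact hS m h
    · rw [List.mem_singleton] at h
      subst h
      intro i j
      fin_cases i <;> fin_cases j
      · exact Or.inl ⟨0, by simp⟩
      · exact Or.inl ⟨1, by simp⟩
      · exact Or.inl ⟨1, by simp⟩
      · exact Or.inl ⟨0, by simp⟩
  · rw [List.prod_append, List.prod_singleton, hR]
    simp [Matrix.mul_apply, Fin.sum_univ_two, Matrix.add_apply, Matrix.smul_apply,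
      Matrix.map_apply, Matrix.one_apply]

/-- **The rung `q = 1` is universal for the permanent**: for EVERY `n`, `per_n` is the
`ε¹`-leading `(0,0)` coefficient of a product of width-2 S-affine matrices over `ℂ[ε][x̄]` —
the `q = 1`, length-free instance of the predicate negated in the open stub `stub_ladder_pos`. -/
theorem rungOne_perPoly (n : ℕ) :
    ∃ ms : List (Matrix (Fin 2) (Fin 2) (MvPolynomial (Fin n × Fin n) (Polynomial ℂ))),
      (∀ m ∈ ms, ∀ i j : Fin 2, (∃ b : Polynomial ℂ, m i j = MvPolynomial.C b) ∨
        (∃ (a b : Polynomial ℂ) (v : Fin n × Fin n),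
          m i j = MvPolynomial.C a * MvPolynomial.X v + MvPolynomial.C b)) ∧
      ∃ G : MvPolynomial (Fin n × Fin n) (Polynomial ℂ),
        ms.prod 0 0 = MvPolynomial.C (Polynomial.X ^ 1) *
            MvPolynomial.map Polynomial.C
              (Literature.Computability.AlgebraicComplexity.perPoly (Fin n) ℂ) +
          MvPolynomial.C (Polynomial.X ^ (1 + 1)) * G := by
  simpa only [pow_one] using
    rungOne_universal (Literature.Computability.AlgebraicComplexity.perPoly (Fin n) ℂ)

/-- **The length-free strengthening of the rung `q = 1` is false** (contrast with the landed
length-free rung `q = 0`, `rung0_ladder_rung_zero`): there is no `n₀` beyond which border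
width-2 S-affine programs of ε-order one — of unrestricted length — fail to compute `per_n`.
Consequently every rung `q ≥ 1` of `stub_ladder_pos` can only hold because of its LENGTH bound. -/
theorem rungOne_not_lengthFree :
    ¬ ∃ n₀ : ℕ, ∀ n ≥ n₀,
      ¬ (∃ ms : List (Matrix (Fin 2) (Fin 2) (MvPolynomial (Fin n × Fin n) (Polynomial ℂ))),
          (∀ m ∈ ms, ∀ i j : Fin 2, (∃ b : Polynomial ℂ, m i j = MvPolynomial.C b) ∨
            (∃ (a b : Polynomial ℂ) (v : Fin n × Fin n),
              m i j = MvPolynomial.C a * MvPolynomial.X v + MvPolynomial.C b)) ∧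
          ∃ G : MvPolynomial (Fin n × Fin n) (Polynomial ℂ),
            ms.prod 0 0 = MvPolynomial.C (Polynomial.X ^ 1) *
                MvPolynomial.map Polynomial.C
                  (Literature.Computability.AlgebraicComplexity.perPoly (Fin n) ℂ) +
              MvPolynomial.C (Polynomial.X ^ (1 + 1)) * G) := by
  rintro ⟨n₀, h⟩
  exact h n₀ le_rfl (rungOne_perPoly n₀)

end Summit.ValiantsHypothesis.ValiantsHypothesis.Cruxes.WordLengthQP.EpsOrderLadder
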